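import Mathlib
import Literature.Analysis.FunctionSpaces.LaplaceFourierSlices
import Literature.Analysis.SpecialFunctions.SemigroupPosDefContinuous
import HarnessLib

/-!
# Laplace structure of the Bochner slices of a positive-definite function on `(0,∞) × V`

Companion of `LaplaceFourierSlices.lean`: with `t ↦ k t 0` bounded on every `[t₀,∞)`, the positive-definite measure-valued
function `t ↦ m_t` of Bochner slices (`bochnerSlice_sum_mul_mul_nonneg`) has, for every set `B ⊆ V`, ONE positive measure
`λ_B` on `[0,∞)` with `m_t(B) = ∫ e^{-tE} dλ_B(E)` for all `t > 0` — Widder's theorem in measure form, continuity in `t`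
being automatic (`exists_measure_laplace_eq_of_semigroupPosDef'`) [cite: Widder1941, Ch. VI Thm. 21],
[cite: BergChristensenRessel1984, Ch. 4 §4].  THEOREMS ONLY; no `sorry`; standard axioms.  Motivation: stub `stub_laplaceFourier`
of LINE g18-A on crux ⟨stmt-QuantumFields-23125⟩.
-/

noncomputable section

open MeasureTheory Complex Set
open scoped ComplexConjugate InnerProductSpace NNReal ENNReal

namespace Literature.Analysis.FunctionSpaces

variable {V : Type*} [NormedAddCommGroup V] [InnerProductSpace ℝ V] [FiniteDimensional ℝ V]
  [MeasurableSpace V] [BorelSpace V]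

/-! ### Every slice functional `t ↦ m_t(B)` is a Laplace transform -/

/-- **Laplace structure of the Bochner slices.**  Under the hypotheses of `bochnerSlice_sum_mul_mul_nonneg` and with
`t ↦ k t 0` bounded on every `[t₀,∞)`, for every set `B ⊆ V` there is ONE positive measure `λ_B` on `[0,∞)` with
`m_t(B) = ∫ e^{-tE} dλ_B(E)` for all `t > 0` (Widder's theorem; continuity in `t` is automatic).
[cite: Widder1941, Ch. VI Thm. 21] [cite: BergChristensenRessel1984, Ch. 4 §4] -/
theorem exists_measure_laplace_bochnerSlice_apply {k : ℝ → V → ℝ}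
    (hPD : ∀ (m : ℕ) (t : Fin m → ℝ) (z : Fin m → V) (c : Fin m → ℝ), (∀ i, 0 < t i) →
      0 ≤ ∑ i, ∑ j, c i * c j * k (t i + t j) (z i - z j))
    (hbdd : ∀ t₀ : ℝ, 0 < t₀ → ∃ M : ℝ, ∀ t : ℝ, t₀ ≤ t → k t 0 ≤ M)
    {m : ℝ → Measure V} (hm : ∀ t, 0 < t → IsFiniteMeasure (m t) ∧ ∀ z, charFun (m t) z = k t z) (B : Set V) :
    ∃ lamB : Measure ℝ, lamB (Iio 0) = 0 ∧ ∀ t : ℝ, 0 < t →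
      Integrable (fun E => Real.exp (-(t * E))) lamB ∧ ((m t) B).toReal = ∫ E, Real.exp (-(t * E)) ∂lamB := by
  refine Literature.MeasureTheory.Integral.exists_measure_laplace_eq_of_semigroupPosDef'
    (fun t => ((m t) B).toReal) (fun n s d hs => bochnerSlice_sum_mul_mul_nonneg hPD hm s d hs B) ?_
  intro t₀ ht₀
  obtain ⟨M, hM⟩ := hbdd t₀ ht₀
  refine ⟨M, fun τ hτ => ?_⟩
  have hτ0 : 0 < τ := lt_of_lt_of_le ht₀ hτ
  haveI := (hm τ hτ0).1
  have hmass : (m τ).real univ = k τ 0 := by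
    have h := (hm τ hτ0).2 0
    rw [charFun_zero] at h
    exact_mod_cast h
  calc ((m τ) B).toReal = (m τ).real B := rfl
    _ ≤ (m τ).real univ := measureReal_mono (subset_univ _)
    _ = k τ 0 := hmass
    _ ≤ M := hM τ hτ

end Literature.Analysis.FunctionSpaces

end
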